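import Literature.AlgebraicGeometry.Frobenioids.PadicFrobenioidPrimitive
import Literature.AlgebraicGeometry.Frobenioids.PadicFrobenioidRmk122
import Literature.AlgebraicGeometry.Frobenioids.PadicFrobenioidZeroMonoid
import HarnessLib

/-!
# Frobenioids II, Example 1.1 (ii) / Theorem 1.2 (v): the split absolutely primitive `p`-adic Frobenioid `(C^⊢, τ^⊢)`

Mochizuki, *The geometry of Frobenioids II*, Kyushu J. Math. **62** (2008) 401–460, §1, Example 1.1 (ii) p. 8
and Theorem 1.2 (v) p. 9 [cite: MochizukiFrdII2008, Thm 1.2 (v) p.9]; the pair "(`p`-adic Frobenioid whose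
divisor monoid is `ord(ℤ_p^⊳)`, characteristic splitting determined by `p`)" is the split Frobenioid
`F_v^⊢ = (C_v^⊢, τ_v^⊢)` of [IUTchI] Ex. 3.3 (i)–(ii) at a good nonarchimedean place.

Consequences, for the canonical absolutely primitive datum `Datum.prim` (`PadicFrobenioidPrimitive.lean`) over
a base `D → D₀` of `p`-adic local fields, of the results of this directory — no new mathematics, only the
instantiations that DE-VACUATE them:

* `Datum.prim_isMonoidData` — over a base of FSM-type, `Φ^⊢` and `B^⊢` are monoids on `D` ([FrdI]
  Def. 1.1 (ii); the standing hypothesis `Datum.IsMonoidData` behind "`C^⊢` is a Frobenioid");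
  `Datum.isMonoidOn_primΦ` holds over EVERY base (all pull-backs of `Φ^⊢` are bijective);
* `Datum.primSplitting` — **`τ^⊢`, the characteristic splitting on `C^⊢` determined by `p`** (Thm. 1.2 (v):
  `Datum.pSplitting` applied to `prim_isAbsolutelyPrimitive`), and `Datum.prim_thm12_v`;
* `Datum.prim_hasBijectivePullbacks` — the constancy hypothesis of the repaired reading (R1) of Rmk. 1.2.2
  holds for `C^⊢`; `Datum.prim_isOfType_isBaseTrivial` — `C^⊢` is of base-trivial type (Thm. 1.2 (v),
  first clause, abc-iut-L1-d10).
-/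

noncomputable section

namespace Literature.AlgebraicGeometry.Frobenioids

namespace PadicFrd

open CategoryTheory Opposite Function

universe v u

variable {D : Type u} [Category.{v} D] {p : ℕ} [Fact p.Prime] (base : D ⥤ PadicFld.{u} p)
  (hloc : ∀ A : D, (base.obj A).IsPadicLocal) (hc : IsConnected D) (he : IsTotallyEpimorphic D)

namespace Datum

/-- The underlying map of an isomorphism of `CommMonCat` is bijective. [cite: MochizukiFrdI2008, Def. 1.1(ii) p.19] -/
private theorem bijective_hom_of_isIso' {X Y : CommMonCat.{u}} (f : X ⟶ Y) [IsIso f] : Bijective f.hom := by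
  refine Function.bijective_iff_has_inverse.mpr ⟨(inv f).hom, fun x => ?_, fun y => ?_⟩
  · change (f ≫ inv f).hom x = x
    rw [IsIso.hom_inv_id]
    rfl
  · change (inv f ≫ f).hom y = y
    rw [IsIso.inv_hom_id]
    rfl

/-- `Φ^⊢ = ℤ_{≥0} · ord(p)` is a monoid on `D` ([FrdI] Def. 1.1 (ii)) over EVERY base: its pull-back maps are
bijective (`prim_map_Φ_bijective`), hence characteristically injective (the monoids `Φ^⊢(A) ≅ ℤ_{≥0}` are
sharp). [cite: MochizukiFrdII2008, Ex 1.1 (ii) p.8] -/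
theorem isMonoidOn_primΦ : IsMonoidOn (Datum.prim base hloc hc he).Φ := by
  refine ⟨fun {A B} g => ?_, fun {A B} g _ => ?_⟩
  · have hsharp : IsSharp ((Datum.prim base hloc hc he).Φ.obj (op B)) :=
      ((Datum.prim base hloc hc he).isMonoprime (op B)).isSharp
    exact isCharInjective_of_injective_of_isSharp _ (prim_map_Φ_bijective base hloc hc he g).1 hsharp
  · exact prim_map_Φ_bijective base hloc hc he g

/-- The pull-back maps of `B^⊢ = B₀|_D ×_{Φ₀^gp} (Φ^⊢)^gp` are injective: an element of `B^⊢(A)` is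
determined by its component in `K_A^×` (`ι^gp` is injective), on which the pull-back is the injective
`K_A^× → K_B^×`. [cite: MochizukiFrdII2008, Ex 1.1 (ii) p.8] -/
theorem prim_map_B_injective {A B : D} (g : B ⟶ A) :
    Injective ((Datum.prim base hloc hc he).B.map g.op).hom := by
  intro b b' h
  -- first components agree after pull-back, hence before (field homomorphisms are injective on units)
  have h1 : Units.map ((base.map g).alg : (base.obj A).K →* (base.obj B).K) b.1.1 =
      Units.map ((base.map g).alg : (base.obj A).K →* (base.obj B).K) b'.1.1 :=
    congrArg (fun q : primBSub base (op B) => q.1.1) h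
  have hx : b.1.1 = b'.1.1 :=
    Units.map_injective (f := ((base.map g).alg : (base.obj A).K →* (base.obj B).K)) (base.map g).alg.injective h1
  -- second components are determined by the first through the (injective) groupified inclusion
  haveI : IsCancelMul ((phiZeroOn base).obj (op A)) := isCancelMul_realification (OrdInt (base.obj A).K)
  have hι : Injective (MonGp.map ((primι base).app (op A)).hom) := MonGp.map_injective _ (primι_injective base _)
  have hγ : b.1.2 = b'.1.2 := by
    apply hι
    have hb : ((divZeroOn base).app (op A)).hom b.1.1 = MonGp.map ((primι base).app (op A)).hom b.1.2 := b.2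
    have hb' : ((divZeroOn base).app (op A)).hom b'.1.1 = MonGp.map ((primι base).app (op A)).hom b'.1.2 := b'.2
    rw [← hb, ← hb', hx]
  exact Subtype.ext (Prod.ext hx hγ)

/-- Over a base of FSM-type, `B^⊢` is a monoid on `D`: pull-backs are (characteristically) injective —
`B^⊢(A)` being a group, its characteristic is trivial — and FSM-morphisms, being isomorphisms, pull back
to isomorphisms. [cite: MochizukiFrdII2008, Ex 1.1 (ii) p.8] -/
theorem isMonoidOn_primB (hD : IsOfFSMType D) : IsMonoidOn (Datum.prim base hloc hc he).B := by
  refine ⟨fun {A B} g => ⟨prim_map_B_injective base hloc hc he g, ?_⟩, fun {A B} g hg => ?_⟩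
  · haveI : Subsingleton (Associates ((Datum.prim base hloc hc he).B.obj (op A))) := ⟨fun x y => by
      obtain ⟨a, rfl⟩ := Associates.mk_surjective x
      obtain ⟨b, rfl⟩ := Associates.mk_surjective y
      obtain ⟨ua, hua⟩ := (Datum.prim base hloc hc he).isUnit_B (op A) a
      obtain ⟨ub, hub⟩ := (Datum.prim base hloc hc he).isUnit_B (op A) b
      exact Associates.mk_eq_mk_iff_associated.mpr
        ⟨ua⁻¹ * ub, by rw [← hua, Units.val_mul, ← mul_assoc, Units.mul_inv, one_mul, hub]⟩⟩
    exact injective_of_subsingleton _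
  · haveI : IsIso g := hD.isIso_of_isFSM g hg
    haveI : IsIso ((Datum.prim base hloc hc he).B.map g.op) := inferInstance
    exact bijective_hom_of_isIso' _

/-- **The standing hypothesis `IsMonoidData` holds for `C^⊢`** over a base of FSM-type (e.g. `D = D₀`, or the
`B^temp(Π, Π°)⁰` of Ex. 1.3): "`Φ`, `B` are monoids on `D`" ([FrdI] Thm. 5.2). [cite: MochizukiFrdII2008, Ex 1.1 (ii) p.8] -/
theorem prim_isMonoidData (hD : IsOfFSMType D) : (Datum.prim base hloc hc he).IsMonoidData :=
  ⟨isMonoidOn_primΦ base hloc hc he, isMonoidOn_primB base hloc hc he hD⟩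

/-- **`τ^⊢`: the characteristic splitting on `C^⊢` determined by `p`** (Thm. 1.2 (v), `Datum.pSplitting`, for
the absolutely primitive datum `Datum.prim`) — the splitting `τ_v^⊢` of the split Frobenioid `F_v^⊢` of
[IUTchI] Ex. 3.3 (ii). [cite: MochizukiFrdII2008, Thm 1.2 (v) p.9] -/
def primSplitting : PreFrobenioid.CharacteristicSplitting (Datum.prim base hloc hc he).structureFunctor :=
  (Datum.prim base hloc hc he).pSplitting (prim_isAbsolutelyPrimitive base hloc hc he)

/-- The `τ`-component of `τ^⊢` is `τ_p`. [cite: MochizukiFrdII2008, Thm 1.2 (v) p.9] -/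
@[simp] theorem primSplitting_τ :
    (primSplitting base hloc hc he).τ = (Datum.prim base hloc hc he).pSplittingSubmonoid := rfl

/-- **Theorem 1.2 (v) for `C^⊢`**, with the characteristic-splitting slot bound to [FrdI] Def. 2.3 (its
antecedent "`Φ` absolutely primitive" HOLDS here, `prim_isAbsolutelyPrimitive`, so both clauses are in force).
[cite: MochizukiFrdII2008, Thm 1.2 (v) p.9] -/
theorem prim_thm12_v (V : Thm12Vocab (Datum.prim base hloc hc he)) : Thm12_v (Datum.prim base hloc hc he) V.bindSplitting :=
  (Datum.prim base hloc hc he).thm12_v_bindSplitting V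

/-- `C^⊢` is of base-trivial type (Thm. 1.2 (v), first clause — abc-iut-L1-d10's
`thm12_isBaseTrivial_of_isAbsolutelyPrimitive`, now unconditionally for `Datum.prim`).
[cite: MochizukiFrdII2008, Thm 1.2 (v) p.9] -/
theorem prim_isOfType_isBaseTrivial :
    PreFrobenioid.IsOfType (PreFrobenioid.IsBaseTrivial (Datum.prim base hloc hc he).structureFunctor) :=
  (Datum.prim base hloc hc he).thm12_isBaseTrivial_of_isAbsolutelyPrimitive (prim_isAbsolutelyPrimitive base hloc hc he)

/-- The constancy hypothesis of the repaired reading (R1) of Rmk. 1.2.2 holds for `C^⊢`: all pull-back maps of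
`Φ^⊢` are bijective. [cite: MochizukiFrdII2008, Rmk 1.2.2 p.10] -/
theorem prim_hasBijectivePullbacks : (Datum.prim base hloc hc he).HasBijectivePullbacks :=
  fun f => prim_map_Φ_bijective base hloc hc he f

end Datum

end PadicFrd

end Literature.AlgebraicGeometry.Frobenioids
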